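import Summits.Ventures.DiscreteObjects.UnitDistance.PlaneSqrt251GadgetData
import HarnessLib

/-!
# The 121-vertex gadget over `ℚ(√251)` has no proper 3-colouring with equal colours at its distance-`2` pair — kernel search
(cell `pub-namedobj`, target (U), seat udg g27)

Framing (verbatim for the cell): lottery ticket; floor = certified bounds/negative ranges.

The bit-vector search of `KernelColouringSearch.lean` (unit propagation + PASS branching, soundness `KBits.search_sound`) run on the
data of `PlaneSqrt251GadgetData.lean` from the initial words (`15 ↦ 0`, `19 ↦ 0`, `0 ↦ 1`, colour `3` forbidden everywhere): every branch
dies (a few hundred branch nodes by the Python mirror `code/udg27/kbits3pq.py`; one `decide +kernel`).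
Consequence (`PlaneSqrt251Four.lean` with `DistanceTwoForcing.lean`): `χ(ℚ(√251)²) = 4`.
-/

namespace Summit.Ventures.DiscreteObjects.UnitDistance

open KBits

/-- The root run: propagate the initial forced colours, then search to the end. -/
def g251run : Bool :=
  match propagate g251nb 40 (g251C0, g251C1, g251C2, 0, 2 ^ 121 - 1) with
  | none => true
  | some st => search g251nb 121 40 [] 121 st

set_option maxHeartbeats 400000000 in
set_option maxRecDepth 200000 in
/-- KERNEL FACT: the search closes (every branch reaches a dead end). -/
theorem g251run_eq : g251run = true := by
  decide +kernel

end Summit.Ventures.DiscreteObjects.UnitDistance
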